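import Mathlib
import HarnessLib
import Summits.NavierStokesRegularity.NavierStokesRegularity.Theorems.WakeRatchetMinimalViscousBlowupEnergyBudget
import Summits.NavierStokesRegularity.NavierStokesRegularity.Theorems.WakeRatchetMinimalViscousBlowupEveryShellFires

/-!
# Route `WakeRatchet`, crux `MinimalViscousBlowup` (stmt-NavierStokesRegularity-22743) — LINE g11-1/g12-2 (ns-idea-1 g12, heart-twin S5b♭):
# NO SUSTAINED STALL — an enveloped trajectory cannot HOLD a shell at a fixed level for more than `D` local time units

ns-idea-1 g12's typed obligation `lines/g12-2/WakeRatchetMinimalViscousBlowupNoSustainedStall.lean` (`def NoSustainedStall`), PROVED here with the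
statement VERBATIM as the type of `noSustainedStall` (binders = the S5 binders of skeleton v3.8 minus blow-up, then the level `b`; `D` is chosen
BEFORE the solution and the shell index).

**Statement.**  `λ = 1+ε₀ > 1`, `ν > 0`, a class table, a solution of the `ν`-viscous lattice on `[0,T)` from one-shell data, (4.5)-regular on every
`[0,T']`, under the envelope `λⁿ‖X_n(t)‖² ≤ C`.  For every level `b > 0` there is `D = D(ε₀, C, ν, b) ≥ 0` such that no shell `k` keeps
`λ^k‖X_k(s)‖² ≥ b` throughout an interval `[t₁,t₂] ⊂ [0,T)` longer than `D/(νλ^{2k})`: `ν·λ^{2k}·(t₂ − t₁) ≤ D`.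
Here `D = 2C⁺λ^{j+1}/(b·ε₀)` with `C⁺ = max C 0` and `λ^j > 128·C⁺√C⁺/(νb)`.

**Proof** (the author's sketch, on the tree's engines).  Block energy `E = Σ_{K ≤ n ≤ N} ½‖X_n‖²` with `K = k − j` (truncated at `0`) and `N ≥ k` large
(`hasDerivWithinAt_blockEnergy` on the window `[0,(t₂+T)/2]`, `hasDerivWithinAt_window_of_clauses`): `E' = Π_{K−1} − Π_N − νΣλ^{2n}‖X_n‖²`.
(i) dissipation `≥ νλ^{2k}‖X_k‖² ≥ νbλ^k` while the level holds; (ii) inflow `|Π_{K−1}| ≤ 64·λ^{5(K−1)/2}‖X_{K−1}‖²‖X_K‖ ≤ 64·C⁺√C⁺·λ^K ≤ ½νbλ^k`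
(`abs_botSum_le_norm_shellVec` + envelope, squared to stay in natural powers; `= 0` if `K = 0`, `botSum_neg_one_eq_zero`) — the bond capacity under
the envelope scales like `λ^K`, the need of shell `k` like `λ^k`; (iii) outflow `|Π_N| ≤ 64M³λ^{−(N+1)} ≤ ¼νbλ^k` (`abs_botSum_le_of_weight10`);
(iv) `E + ¼νbλ^k(· − t₁)` is antitone on `[t₁,t₂]`, `E ≥ 0`, `E(t₁) ≤ ½C⁺λ^{−K}·λ/(λ−1)` (geometric sum) ⇒ `νλ^{2k}(t₂−t₁) ≤ 2C⁺λ^{k−K}λ/(bε₀) ≤ D`.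
FILING NORM (KEY-NS #208 (4)): the hypothesis block (trajectory clauses + envelope + held level) is inhabited by the zero trajectory with `b > C⁺`
only vacuously; a non-vacuous toy inhabitant needs a genuine lattice trajectory holding a level — none cheap (said, not shown).
MODEL lattice ODEs only; nothing here concerns the Navier–Stokes equations (no NS regularity statement is proved).
`--supports stmt-NavierStokesRegularity-22743 --as helper`.
[cite: Tao2016AveragedNS, §4 Lemma 4.1 (4.5), proof of (4.13); BarbatoMorandinRomito2011, §3.1]
-/

noncomputable section

-- the summit and its single sub-problem share the name (CONVENTIONS §1)
set_option linter.dupNamespace false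

open Set Filter Topology

namespace Summit.NavierStokesRegularity.NavierStokesRegularity.Theorems.MinimalViscousBlowup.ThresholdRay

open Literature.Analysis.FluidPDE Literature.Analysis.FluidPDE.TaoCascade

/-- **Bond capacity under the envelope.**  If `λ^{K₁}‖X_{K₁}‖² ≤ C⁺` and `λ^{K₁+1}‖X_{K₁+1}‖² ≤ C⁺` (`λ = 1+ε₀ ≥ 1`, `C⁺ ≥ 0`), then
`λ^{5K₁/2}‖X_{K₁}‖²‖X_{K₁+1}‖ ≤ C⁺√C⁺·λ^{K₁+1}` (squares compared: `λ^{5K₁}a²c² ≤ λ^{5K₁+3}a²c² = λ^{2K₁+2}(λ^{K₁}a)²(λ^{K₁+1}c²)`).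
[cite: Tao2016AveragedNS, §4 (4.1)] -/
theorem fluxWeight_mul_le_of_envelope {ε₀ Cp : ℝ} (hε : 0 ≤ ε₀) (hCp : 0 ≤ Cp) {X : Fin 4 → ℤ → ℝ → ℝ} {K₁ : ℕ} {τ : ℝ}
    (he1 : (1 + ε₀) ^ K₁ * ‖shellVec X (K₁ : ℤ) τ‖ ^ 2 ≤ Cp)
    (he2 : (1 + ε₀) ^ (K₁ + 1) * ‖shellVec X ((K₁ : ℤ) + 1) τ‖ ^ 2 ≤ Cp) :
    (1 + ε₀) ^ ((5 : ℝ) * ((K₁ : ℕ) : ℤ) / 2) * ‖shellVec X (K₁ : ℤ) τ‖ ^ 2 * ‖shellVec X ((K₁ : ℤ) + 1) τ‖ ≤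
      Cp * Real.sqrt Cp * (1 + ε₀) ^ (K₁ + 1) := by
  have hl0 : (0 : ℝ) < 1 + ε₀ := by linarith
  have hl1 : (1 : ℝ) ≤ 1 + ε₀ := by linarith
  set P5 : ℝ := (1 + ε₀) ^ ((5 : ℝ) * ((K₁ : ℕ) : ℤ) / 2) with hP5
  have hP50 : 0 < P5 := Real.rpow_pos_of_pos hl0 _
  have hP5sq : P5 ^ 2 = (1 + ε₀) ^ (5 * K₁) := by
    have he : (5 : ℝ) * (((K₁ : ℕ) : ℤ) : ℝ) / 2 * ((2 : ℕ) : ℝ) = ((5 * K₁ : ℕ) : ℝ) := by push_cast; ring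
    rw [hP5, ← Real.rpow_natCast _ 2, ← Real.rpow_mul hl0.le, he, Real.rpow_natCast]
  set a : ℝ := ‖shellVec X (K₁ : ℤ) τ‖ ^ 2 with ha
  set c : ℝ := ‖shellVec X ((K₁ : ℤ) + 1) τ‖ with hc
  have ha0 : 0 ≤ a := sq_nonneg _
  have hc0 : 0 ≤ c := norm_nonneg _
  have h3 : ((1 + ε₀) ^ K₁ * a) ^ 2 * ((1 + ε₀) ^ (K₁ + 1) * c ^ 2) ≤ Cp ^ 2 * Cp :=
    mul_le_mul (pow_le_pow_left₀ (by positivity) he1 2) he2 (by positivity) (by positivity)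
  have hsq : (P5 * a * c) ^ 2 ≤ (Cp * Real.sqrt Cp * (1 + ε₀) ^ (K₁ + 1)) ^ 2 := by
    have hR : (Cp * Real.sqrt Cp * (1 + ε₀) ^ (K₁ + 1)) ^ 2 = (1 + ε₀) ^ (2 * K₁ + 2) * (Cp ^ 2 * Cp) := by
      rw [mul_pow, mul_pow, Real.sq_sqrt hCp, ← pow_mul]; ring
    have hL : (P5 * a * c) ^ 2 = (1 + ε₀) ^ (5 * K₁) * (a ^ 2 * c ^ 2) := by rw [mul_pow, mul_pow, hP5sq]; ring
    rw [hR, hL]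
    have hac : 0 ≤ a ^ 2 * c ^ 2 := by positivity
    have hmono : (1 + ε₀) ^ (5 * K₁) ≤ (1 + ε₀) ^ (5 * K₁ + 3) := pow_le_pow_right₀ hl1 (by omega)
    have hid : (1 + ε₀) ^ (5 * K₁ + 3) * (a ^ 2 * c ^ 2) =
        (1 + ε₀) ^ (2 * K₁ + 2) * (((1 + ε₀) ^ K₁ * a) ^ 2 * ((1 + ε₀) ^ (K₁ + 1) * c ^ 2)) := by ring
    calc (1 + ε₀) ^ (5 * K₁) * (a ^ 2 * c ^ 2) ≤ (1 + ε₀) ^ (5 * K₁ + 3) * (a ^ 2 * c ^ 2) :=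
          mul_le_mul_of_nonneg_right hmono hac
      _ = (1 + ε₀) ^ (2 * K₁ + 2) * (((1 + ε₀) ^ K₁ * a) ^ 2 * ((1 + ε₀) ^ (K₁ + 1) * c ^ 2)) := hid
      _ ≤ (1 + ε₀) ^ (2 * K₁ + 2) * (Cp ^ 2 * Cp) := mul_le_mul_of_nonneg_left h3 (by positivity)
  exact (pow_le_pow_iff_left₀ (by positivity) (by positivity) two_ne_zero).1 hsq

/-- **NoSustainedStall** (ns-idea-1 g12's typed obligation, statement VERBATIM: binders = the S5 binders of skeleton v3.8 minus blow-up, then the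
level `b`; `D` is chosen BEFORE the solution and the shell index).  An enveloped regular trajectory of the `ν`-viscous cascade lattice cannot hold a
shell `k` at level `λ^k‖X_k‖² ≥ b` on `[t₁,t₂] ⊂ [0,T)` for longer than `D/(νλ^{2k})` local units: `ν·λ^{2k}·(t₂ − t₁) ≤ D`.
[cite: Tao2016AveragedNS, §4 Lemma 4.1 (4.5), proof of (4.13); BarbatoMorandinRomito2011, §3.1] -/
theorem noSustainedStall : ∀ ε₀ : ℝ, 0 < ε₀ → ∀ R : ℝ, 1 ≤ R →
    ∀ (α : Fin 4 → Fin 4 → Fin 4 → ℤ × ℤ × ℤ → ℝ) (X₀ : Fin 4 → ℝ),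
    Literature.Analysis.FluidPDE.TaoCascade.InTableClass R α →
    ∀ (ν T C : ℝ), 0 < ν → 0 < T → ∀ b : ℝ, 0 < b → ∃ D : ℝ, 0 ≤ D ∧
    ∀ (X : Fin 4 → ℤ → ℝ → ℝ),
    (∀ i n, ContDiffOn ℝ 1 (X i n) (Set.Ico 0 T)) →
    (∀ i n, X i n 0 = if n = 0 then X₀ i else 0) →
    (∀ i n t, n < 0 → X i n t = 0) →
    (∀ i n t, 0 ≤ t → t < T → derivWithin (X i n) (Set.Ici 0) t =
      Literature.Analysis.FluidPDE.TaoCascade.quadTerm ε₀ α X i n t - ν * (1 + ε₀) ^ ((2 : ℝ) * n) * X i n t) →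
    (∀ T' : ℝ, 0 < T' → T' < T → ∃ M : ℝ, ∀ t : ℝ, 0 ≤ t → t ≤ T' →
      ∀ (i : Fin 4) (n : ℤ), (1 + (1 + ε₀) ^ ((10 : ℝ) * n)) * |X i n t| ≤ M) →
    (∀ (n : ℤ) (t : ℝ), 0 ≤ t → t < T →
      (1 + ε₀) ^ n * ‖Literature.Analysis.FluidPDE.TaoCascade.shellVec X n t‖ ^ 2 ≤ C) →
    ∀ (k : ℕ) (t₁ t₂ : ℝ), 0 ≤ t₁ → t₁ ≤ t₂ → t₂ < T →
      (∀ s : ℝ, t₁ ≤ s → s ≤ t₂ → b ≤ (1 + ε₀) ^ k * ‖Literature.Analysis.FluidPDE.TaoCascade.shellVec X k s‖ ^ 2) →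
      ν * (1 + ε₀) ^ (2 * k) * (t₂ - t₁) ≤ D := by
  intro ε₀ hε R _hR α X₀ hα ν T C hν hT b hb
  have hl0 : (0 : ℝ) < 1 + ε₀ := by linarith
  have hl1 : (1 : ℝ) < 1 + ε₀ := by linarith
  have hl1' : (1 : ℝ) ≤ 1 + ε₀ := hl1.le
  have hcan : IsCancellingCoeff α := hα.2.1
  have hα1 : ∀ i₁ i₂ i₃ : Fin 4, |α i₁ i₂ i₃ (0, 0, 1)| ≤ 1 := fun i₁ i₂ i₃ =>
    abs_le_one_of_inTableClass hα i₁ i₂ i₃ _ (by rw [mem_shiftSet_iff]; simp)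
  -- constants chosen before the solution: `C⁺`, the bond capacity `G = 64 C⁺ √C⁺`, the depth `j`, and `D`
  set Cp : ℝ := max C 0 with hCp
  have hCp0 : 0 ≤ Cp := le_max_right _ _
  have hCCp : C ≤ Cp := le_max_left _ _
  set G : ℝ := 64 * Cp * Real.sqrt Cp with hG
  have hG0 : 0 ≤ G := by positivity
  obtain ⟨j, hj⟩ := pow_unbounded_of_one_lt (2 * G / (ν * b)) hl1
  have hjG : 2 * G ≤ ν * b * (1 + ε₀) ^ j := by
    have := (div_lt_iff₀ (by positivity : (0 : ℝ) < ν * b)).1 hj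
    linarith
  refine ⟨2 * Cp * (1 + ε₀) ^ (j + 1) / (b * ε₀), by positivity, ?_⟩
  intro X hcd _hinit hlow hmot hreg henv k t₁ t₂ ht₁ ht₁₂ ht₂ hlevel
  -- the window `[0, T']`, `T' = (t₂ + T)/2`, its (4.5) bound `M ≥ 0`, and the lattice law within it
  set T' : ℝ := (t₂ + T) / 2 with hT'
  have hT'0 : 0 < T' := by rw [hT']; linarith
  have ht₂T' : t₂ < T' := by rw [hT']; linarith
  have hT'T : T' < T := by rw [hT']; linarith
  obtain ⟨M₀, hM₀⟩ := hreg T' hT'0 hT'T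
  set M : ℝ := max M₀ 0 with hMdef
  have hM0 : 0 ≤ M := le_max_right _ _
  have hM : ∀ τ ∈ Icc (0 : ℝ) T', ∀ (i : Fin 4) (n : ℤ), (1 + (1 + ε₀) ^ ((10 : ℝ) * n)) * |X i n τ| ≤ M :=
    fun τ hτ i n => (hM₀ τ hτ.1 hτ.2 i n).trans (le_max_left _ _)
  have hder := hasDerivWithinAt_window_of_clauses (ε₀ := ε₀) (ν := ν) hcd hmot hT'T
  -- the block bottom `K = k − j` (truncated subtraction) and top `N ≥ k`
  set K : ℕ := k - j with hK
  have hKk : K ≤ k := Nat.sub_le k j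
  have hkK : k ≤ K + j := by omega
  set r : ℝ := (1 + ε₀)⁻¹ with hr
  have hr0 : 0 < r := inv_pos.2 hl0
  have hr1 : r < 1 := inv_lt_one_of_one_lt₀ hl1
  have hrl : r * (1 + ε₀) = 1 := by rw [hr]; exact inv_mul_cancel₀ hl0.ne'
  have hνbk : 0 < ν * b * (1 + ε₀) ^ k := by positivity
  obtain ⟨N₁, hN₁⟩ := exists_pow_lt_of_lt_one
    (show 0 < ν * b * (1 + ε₀) ^ k / 4 / (64 * M ^ 3 + 1) by positivity) hr1
  set N : ℕ := N₁ + k with hN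
  set L : ℕ := N + 1 with hL
  have hkL : k < L := by omega
  have hKL : K ≤ L := by omega
  -- (iii) the outflow at the top of the block is small
  have hout : ∀ τ ∈ Icc (0 : ℝ) T', |botSum ε₀ α X ((L : ℤ) - 1) τ| ≤ ν * b * (1 + ε₀) ^ k / 4 := by
    intro τ hτ
    have h := abs_botSum_le_of_weight10 (m := 4) hε hM0 hα1 (hM τ hτ) N
    have hcast : ((L : ℤ) - 1 : ℤ) = ((N : ℕ) : ℤ) := by rw [hL]; push_cast; ring
    rw [hcast]
    refine h.trans ?_
    have hrN : r ^ (N + 1) ≤ r ^ N₁ := pow_le_pow_of_le_one hr0.le hr1.le (by omega)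
    have h64 : ((4 : ℕ) : ℝ) ^ 3 = 64 := by norm_num
    rw [h64]
    have h1 : 64 * M ^ 3 * r ^ (N + 1) ≤ (64 * M ^ 3 + 1) * r ^ N₁ := by
      have := pow_nonneg hr0.le N₁
      have hM3 : 0 ≤ 64 * M ^ 3 := by positivity
      nlinarith [mul_le_mul_of_nonneg_left hrN hM3]
    have h2 : (64 * M ^ 3 + 1) * r ^ N₁ ≤ ν * b * (1 + ε₀) ^ k / 4 := by
      have := (lt_div_iff₀ (by positivity : (0 : ℝ) < 64 * M ^ 3 + 1)).1 hN₁
      linarith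
    exact h1.trans h2
  -- (ii) the inflow at the bottom of the block: bond capacity `λ^K` against the need `λ^k`
  have hin : ∀ τ ∈ Icc (0 : ℝ) T', |botSum ε₀ α X ((K : ℤ) - 1) τ| ≤ ν * b * (1 + ε₀) ^ k / 2 := by
    intro τ hτ
    have hτT : τ < T := lt_of_le_of_lt hτ.2 hT'T
    rcases Nat.eq_zero_or_pos K with hK0 | hKpos
    · -- `K = 0`: no shells below the datum
      have hcast : ((K : ℤ) - 1 : ℤ) = -1 := by rw [hK0]; norm_num
      rw [hcast, botSum_neg_one_eq_zero (fun i n t hn _ => hlow i n t hn) hτ.1, abs_zero]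
      positivity
    · -- `K = K₁ + 1 ≥ 1`, so `k = K + j`
      obtain ⟨K₁, hK₁⟩ : ∃ K₁, K = K₁ + 1 := ⟨K - 1, by omega⟩
      have hkKj : k = K + j := by omega
      have hcast : ((K : ℤ) - 1 : ℤ) = ((K₁ : ℕ) : ℤ) := by rw [hK₁]; push_cast; ring
      rw [hcast]
      have he1 : (1 + ε₀) ^ K₁ * ‖shellVec X (K₁ : ℤ) τ‖ ^ 2 ≤ Cp := by
        have := henv (K₁ : ℤ) τ hτ.1 hτT
        rw [zpow_natCast] at this
        exact this.trans hCCp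
      have he2 : (1 + ε₀) ^ (K₁ + 1) * ‖shellVec X ((K₁ : ℤ) + 1) τ‖ ^ 2 ≤ Cp := by
        have hz : (1 + ε₀) ^ ((K₁ : ℤ) + 1) = (1 + ε₀) ^ (K₁ + 1) := by
          rw [zpow_add_one₀ hl0.ne', zpow_natCast, pow_succ]
        have := henv ((K₁ : ℤ) + 1) τ hτ.1 hτT
        rw [hz] at this
        exact this.trans hCCp
      have hcap := fluxWeight_mul_le_of_envelope hε.le hCp0 he1 he2
      have h64 : ((4 : ℕ) : ℝ) ^ 3 = 64 := by norm_num
      calc |botSum ε₀ α X (K₁ : ℤ) τ|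
          ≤ ((4 : ℕ) : ℝ) ^ 3 * (1 + ε₀) ^ ((5 : ℝ) * ((K₁ : ℕ) : ℤ) / 2) * ‖shellVec X (K₁ : ℤ) τ‖ ^ 2 *
              ‖shellVec X ((K₁ : ℤ) + 1) τ‖ := abs_botSum_le_norm_shellVec hl0 hα1 X (K₁ : ℤ) τ
        _ = 64 * ((1 + ε₀) ^ ((5 : ℝ) * ((K₁ : ℕ) : ℤ) / 2) * ‖shellVec X (K₁ : ℤ) τ‖ ^ 2 *
              ‖shellVec X ((K₁ : ℤ) + 1) τ‖) := by rw [h64]; ring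
        _ ≤ 64 * (Cp * Real.sqrt Cp * (1 + ε₀) ^ (K₁ + 1)) := mul_le_mul_of_nonneg_left hcap (by norm_num)
        _ = G * (1 + ε₀) ^ K := by rw [hG, hK₁]; ring
        _ ≤ ν * b * (1 + ε₀) ^ j / 2 * (1 + ε₀) ^ K :=
            mul_le_mul_of_nonneg_right (by linarith) (pow_nonneg hl0.le _)
        _ = ν * b * (1 + ε₀) ^ k / 2 := by rw [hkKj, pow_add]; ring
  -- the block energy `f` and its derivative `f'` within `[0,T']`
  set f : ℝ → ℝ := fun w => ∑ n ∈ Finset.Ico K L, ∑ i : Fin 4, (1 / 2 : ℝ) * X i n w ^ 2 with hf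
  set f' : ℝ → ℝ := fun w => botSum ε₀ α X ((K : ℤ) - 1) w - botSum ε₀ α X ((L : ℤ) - 1) w -
    ν * ∑ n ∈ Finset.Ico K L, (1 + ε₀) ^ ((2 : ℝ) * (n : ℤ)) * ∑ i : Fin 4, X i n w ^ 2 with hf'
  have hfd : ∀ x ∈ Icc (0 : ℝ) T', HasDerivWithinAt f (f' x) (Icc 0 T') x := fun x hx =>
    hasDerivWithinAt_blockEnergy (ε₀ := ε₀) (ν := ν) hcan (fun i n => hder i n x hx) hKL
  have hf0 : ∀ w, 0 ≤ f w := fun w =>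
    Finset.sum_nonneg fun n _ => Finset.sum_nonneg fun i _ => by positivity
  -- (i) the dissipation floor while the level holds: `ν Σ λ^{2n} Σ_i X² ≥ ν b λ^k`
  have hdiss : ∀ x, t₁ ≤ x → x ≤ t₂ →
      ν * b * (1 + ε₀) ^ k ≤ ν * ∑ n ∈ Finset.Ico K L, (1 + ε₀) ^ ((2 : ℝ) * (n : ℤ)) * ∑ i : Fin 4, X i n x ^ 2 := by
    intro x hx₁ hx₂
    have hmem : k ∈ Finset.Ico K L := Finset.mem_Ico.2 ⟨hKk, hkL⟩
    have hsingle : (1 + ε₀) ^ ((2 : ℝ) * ((k : ℕ) : ℤ)) * ∑ i : Fin 4, X i k x ^ 2 ≤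
        ∑ n ∈ Finset.Ico K L, (1 + ε₀) ^ ((2 : ℝ) * (n : ℤ)) * ∑ i : Fin 4, X i n x ^ 2 :=
      Finset.single_le_sum (f := fun n : ℕ => (1 + ε₀) ^ ((2 : ℝ) * (n : ℤ)) * ∑ i : Fin 4, X i n x ^ 2)
        (fun n _ => mul_nonneg (Real.rpow_nonneg hl0.le _) (Finset.sum_nonneg fun i _ => sq_nonneg _)) hmem
    have hw : (1 + ε₀) ^ ((2 : ℝ) * ((k : ℕ) : ℤ)) = (1 + ε₀) ^ k * (1 + ε₀) ^ k := by
      rw [show ((2 : ℝ) * (((k : ℕ) : ℤ) : ℝ)) = ((2 * k : ℕ) : ℝ) by push_cast; ring, Real.rpow_natCast, two_mul, pow_add]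
    have hsq : ∑ i : Fin 4, X i k x ^ 2 = ‖shellVec X (k : ℤ) x‖ ^ 2 := (norm_shellVec_sq X k x).symm
    rw [hw, hsq] at hsingle
    have hlev := hlevel x hx₁ hx₂
    have h1 : b * (1 + ε₀) ^ k ≤ (1 + ε₀) ^ k * (1 + ε₀) ^ k * ‖shellVec X (k : ℤ) x‖ ^ 2 := by
      have := mul_le_mul_of_nonneg_left hlev (pow_nonneg hl0.le k)
      linarith [this]
    nlinarith [hsingle, h1, hν]
  -- so `f' ≤ −¼ ν b λ^k` on `[t₁,t₂]`
  have hf'le : ∀ x, t₁ ≤ x → x ≤ t₂ → f' x ≤ -(ν * b * (1 + ε₀) ^ k / 4) := by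
    intro x hx₁ hx₂
    have hxw : x ∈ Icc (0 : ℝ) T' := ⟨ht₁.trans hx₁, (hx₂.trans ht₂T'.le)⟩
    have e1 := (abs_le.1 (hin x hxw)).2
    have e2 := (abs_le.1 (hout x hxw)).1
    have e3 := hdiss x hx₁ hx₂
    simp only [hf']
    linarith
  -- (iv) `g = f + ¼ ν b λ^k (· − t₁)` is antitone on `[t₁,t₂]`
  set g : ℝ → ℝ := fun w => f w + ν * b * (1 + ε₀) ^ k / 4 * (w - t₁) with hg
  have hgd : ∀ x ∈ Icc t₁ t₂, HasDerivWithinAt g (f' x + ν * b * (1 + ε₀) ^ k / 4) (Icc t₁ t₂) x := by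
    intro x hx
    have hxw : x ∈ Icc (0 : ℝ) T' := ⟨ht₁.trans hx.1, (hx.2.trans ht₂T'.le)⟩
    have h1 : HasDerivWithinAt f (f' x) (Icc t₁ t₂) x :=
      (hfd x hxw).mono fun u hu => ⟨ht₁.trans hu.1, hu.2.trans ht₂T'.le⟩
    have h2 : HasDerivWithinAt (fun w => ν * b * (1 + ε₀) ^ k / 4 * (w - t₁)) (ν * b * (1 + ε₀) ^ k / 4 * 1) (Icc t₁ t₂) x :=
      ((hasDerivWithinAt_id x _).sub_const t₁).const_mul _
    rw [mul_one] at h2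
    exact h1.add h2
  have hanti : AntitoneOn g (Icc t₁ t₂) := by
    refine antitoneOn_of_hasDerivWithinAt_nonpos (convex_Icc t₁ t₂)
      (fun s hs => (hgd s hs).continuousWithinAt)
      (fun s hs => (hgd s (interior_subset hs)).mono interior_subset) fun s hs => ?_
    rw [interior_Icc] at hs
    have := hf'le s hs.1.le hs.2.le
    linarith
  have hcmp : g t₂ ≤ g t₁ := hanti (left_mem_Icc.2 ht₁₂) (right_mem_Icc.2 ht₁₂) ht₁₂
  have hgap : ν * b * (1 + ε₀) ^ k / 4 * (t₂ - t₁) ≤ f t₁ := by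
    have h0 := hf0 t₂
    simp only [hg, sub_self, mul_zero, add_zero] at hcmp
    linarith
  -- the block energy at `t₁` under the envelope: `f(t₁) ≤ ½ C⁺ r^K / (1 − r)`
  have hft₁ : f t₁ ≤ (1 / 2 : ℝ) * Cp * (r ^ K / (1 - r)) := by
    have ht₁T : t₁ < T := lt_of_le_of_lt ht₁₂ ht₂
    have hterm : ∀ n ∈ Finset.Ico K L, ∑ i : Fin 4, (1 / 2 : ℝ) * X i n t₁ ^ 2 ≤ (1 / 2 : ℝ) * Cp * r ^ n := by
      intro n _
      have he := henv (n : ℤ) t₁ ht₁ ht₁T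
      rw [zpow_natCast] at he
      have hsq : ∑ i : Fin 4, (1 / 2 : ℝ) * X i n t₁ ^ 2 = (1 / 2 : ℝ) * ‖shellVec X (n : ℤ) t₁‖ ^ 2 := by
        rw [norm_shellVec_sq, Finset.mul_sum]
      rw [hsq]
      have hrn : r ^ n * (1 + ε₀) ^ n = 1 := by rw [← mul_pow, hrl, one_pow]
      have hX : ‖shellVec X (n : ℤ) t₁‖ ^ 2 ≤ Cp * r ^ n := by
        have h1 : r ^ n * ((1 + ε₀) ^ n * ‖shellVec X (n : ℤ) t₁‖ ^ 2) ≤ r ^ n * Cp :=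
          mul_le_mul_of_nonneg_left (he.trans hCCp) (pow_nonneg hr0.le n)
        calc ‖shellVec X (n : ℤ) t₁‖ ^ 2 = r ^ n * (1 + ε₀) ^ n * ‖shellVec X (n : ℤ) t₁‖ ^ 2 := by rw [hrn, one_mul]
          _ = r ^ n * ((1 + ε₀) ^ n * ‖shellVec X (n : ℤ) t₁‖ ^ 2) := by ring
          _ ≤ r ^ n * Cp := h1
          _ = Cp * r ^ n := mul_comm _ _
      linarith
    calc f t₁ = ∑ n ∈ Finset.Ico K L, ∑ i : Fin 4, (1 / 2 : ℝ) * X i n t₁ ^ 2 := rfl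
      _ ≤ ∑ n ∈ Finset.Ico K L, (1 / 2 : ℝ) * Cp * r ^ n := Finset.sum_le_sum hterm
      _ = (1 / 2 : ℝ) * Cp * ∑ n ∈ Finset.Ico K L, r ^ n := by rw [Finset.mul_sum]
      _ ≤ (1 / 2 : ℝ) * Cp * (r ^ K / (1 - r)) :=
          mul_le_mul_of_nonneg_left (geom_sum_Ico_le_of_lt_one hr0.le hr1) (by positivity)
  -- assemble: `ν λ^{2k} (t₂ − t₁) ≤ 2 C⁺ λ^{k−K} λ/(b ε₀) ≤ D`
  have h1r : 1 - r = ε₀ / (1 + ε₀) := by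
    rw [hr]; field_simp; ring
  have hrK : r ^ K * (1 + ε₀) ^ k ≤ (1 + ε₀) ^ j := by
    obtain ⟨d, hd⟩ := Nat.exists_eq_add_of_le hKk
    have hdj : d ≤ j := by omega
    rw [hd, pow_add, ← mul_assoc, ← mul_pow, hrl, one_pow, one_mul]
    exact pow_le_pow_right₀ hl1' hdj
  have hmain : ν * (1 + ε₀) ^ (2 * k) * (t₂ - t₁) =
      (4 * (1 + ε₀) ^ k / b) * (ν * b * (1 + ε₀) ^ k / 4 * (t₂ - t₁)) := by
    rw [two_mul, pow_add]; field_simp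
  rw [hmain]
  calc 4 * (1 + ε₀) ^ k / b * (ν * b * (1 + ε₀) ^ k / 4 * (t₂ - t₁))
      ≤ 4 * (1 + ε₀) ^ k / b * ((1 / 2 : ℝ) * Cp * (r ^ K / (1 - r))) :=
        mul_le_mul_of_nonneg_left (hgap.trans hft₁) (by positivity)
    _ = 2 * Cp * (r ^ K * (1 + ε₀) ^ k) * (1 + ε₀) / (b * ε₀) := by
        rw [h1r]; field_simp; ring
    _ ≤ 2 * Cp * (1 + ε₀) ^ j * (1 + ε₀) / (b * ε₀) := by gcongr
    _ = 2 * Cp * (1 + ε₀) ^ (j + 1) / (b * ε₀) := by rw [pow_succ]; ring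

end Summit.NavierStokesRegularity.NavierStokesRegularity.Theorems.MinimalViscousBlowup.ThresholdRay

end
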